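import Mathlib.Order.Filter.CountablyGenerated
import Mathlib.CategoryTheory.Endomorphism
import Literature.AnabelianGeometry.SemiGraphs.TemperoidsHomHom
import Literature.AnabelianGeometry.SemiGraphs.TemperoidsGaloisObjectsProofs
import HarnessLib

/-!
# The Galois pro-system of the base `B^temp(Π)⁰` and the identification `Aut = Π`

Mochizuki, *The geometry of Frobenioids II*, Kyushu J. Math. **62** (2008), §2, proof of Theorem 2.4 (ii),
author's manuscript p. 20 l.−5 – p. 21 l. 6 [cite: MochizukiFrdII2008, Thm 2.4 (ii) p.20]: the base of a
`p`-adic Frobenioid is the connected quasi-temperoid `D = B^temp(Π, Π°)⁰` ([FrdII] Ex. 1.3), and "by varying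
the objects `Aᵢ`" of a universal covering one reconstructs the pair `(Gᵢ, K̄ᵢ^×)` "well-defined up to …
automorphisms of the pair induced by elements of `G₂`".  The Frobenioid-theoretic half of that sentence is in
the tree (abc-iut-w5-d188, `PadicFrobenioidFieldUnitsColimit` / `…Equivariance`: isomorphisms of direct
limits along ANY system `c : J ⥤ Dᵒᵖ`, equivariant for every natural endomorphism of `c`).  This PROOF-ONLY
file supplies the BASE-STRUCTURE half recorded as GAP-LEDGER row **G-w5d188-1 (a)** (cell abc-iut), i.e.
the classical Galois-category fact ([SemiAnbd] Remark 3.2.1 p. 35: "`π₁^temp(X)` … well-defined, up to inner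
automorphism"; SGA 1 V §4–5 in the pro-object form) over the tree's vocabulary
`ConnectedPart (BTemp Π)`:

* `galoisSystem hG N hN : ℕ ⥤ (ConnectedPart (BTemp Π))ᵒᵖ` — the pro-system `k ↦ Π/N_k` of quotient objects
  along an antitone sequence `N` of open normal subgroups, with the projections as transition maps;
* `isGaloisObj_galoisSystem` — every term is a Galois object of `B^temp(Π)` ([SemiAnbd] Rmk 3.1.3);
* `galoisSystem_cofinal` — when `N` is cofinal among the neighbourhoods of `1`, every connected object
  receives a morphism from some term (the honest form of "universal covering"; NB the pro-object is NOT an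
  initial functor in Mathlib's sense — two morphisms `Π/N → X` differing by a deck transformation never
  equalise along the projections);
* `toAut` / `toAutMulEquiv` — the group isomorphism `Π ≃* Aut (galoisSystem hG N hN)`, `g ↦` the compatible
  family of right translations `xN_k ↦ x g N_k` (injective by the "separated" clause of temperedness and
  cofinality, surjective by the "complete" clause); `toAut_app_apply` is the action formula on cosets;
* `exists_galois_cofinal_system_aut_equiv` — the packaged existence statement of G-w5d188-1 (a), for `Π`
  tempered and Galois-countable ([IUTchI] Rmk 2.5.3 (ii) (E7): second countable, so that a cofinal SEQUENCE
  of open normal subgroups exists).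

Reused, not re-declared: `BTemp.Q`/`proj`/`rightMul`/`orbitMap`/`stab` (abc-iut-L3, `TemperoidsResProofs`,
`TemperoidsHomTorsor`, `TemperoidsHomHom`), `GaloisObjects.isConnectedObj_quotientObj` /
`isGaloisObj_of_iso_quotientObj` (`TemperoidsGaloisObjectsProofs`).  Theorems and the three auxiliary
constructions only; no `Prop`-valued definition; nothing here bears on [IUTchIII] Cor. 3.12.
-/

noncomputable section

namespace Literature.AlgebraicGeometry.Frobenioids

open CategoryTheory Opposite Topology Filter
open Literature.AnabelianGeometry.SemiGraphs
open Literature.AlgebraicGeometry.Frobenioids.QuasiTemperoid.BTempConnected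

universe u

namespace BaseGaloisSystem

variable {G : Type u} [Group G] [TopologicalSpace G] [IsTopologicalGroup G] (hG : IsTempered G)

/-! ### The quotient objects `Π/N` in the connected part and their structure maps -/

/-- `Π/N` (`N` open normal) as an object of the connected part `B^temp(Π)⁰` ([SemiAnbd] Rmk 3.1.3: it is
connected, indeed Galois). [cite: MochizukiSemiAnbd2006, Rmk 3.1.3 p.34] -/
abbrev QC (N : OpenNormalSubgroup G) : ConnectedPart (BTemp G) :=
  ⟨BTemp.Q hG N, GaloisObjects.isConnectedObj_quotientObj hG N.toSubgroup N.isOpen'⟩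

/-- The underlying `B^temp(Π)`-object of `QC hG N` is `Π/N`. [cite: MochizukiSemiAnbd2006, Rmk 3.1.2 p.33] -/
@[simp] theorem QC_obj (N : OpenNormalSubgroup G) : (QC hG N).obj = BTemp.Q hG N := rfl

/-- The projection `Π/N → Π/M` (`N ≤ M`) in the connected part. [cite: MochizukiSemiAnbd2006, Rmk 3.1.2 p.33] -/
def projC {N M : OpenNormalSubgroup G} (h : N ≤ M) : QC hG N ⟶ QC hG M :=
  ObjectProperty.homMk (BTemp.proj hG h)

/-- Right translation `xN ↦ x g N` in the connected part. [cite: MochizukiSemiAnbd2006, Rmk 3.1.2 p.33] -/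
def rightMulC (N : OpenNormalSubgroup G) (g : G) : QC hG N ⟶ QC hG N :=
  ObjectProperty.homMk (BTemp.rightMul hG N g)

/-- Underlying `B^temp`-morphism of `projC`. [cite: MochizukiSemiAnbd2006, Rmk 3.1.2 p.33] -/
@[simp] theorem projC_hom {N M : OpenNormalSubgroup G} (h : N ≤ M) :
    (projC hG h).hom = BTemp.proj hG h := rfl

/-- Underlying `B^temp`-morphism of `rightMulC`. [cite: MochizukiSemiAnbd2006, Rmk 3.1.2 p.33] -/
@[simp] theorem rightMulC_hom (N : OpenNormalSubgroup G) (g : G) :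
    (rightMulC hG N g).hom = BTemp.rightMul hG N g := rfl

/-- `projC` along `N ≤ N` is the identity. [cite: MochizukiSemiAnbd2006, Rmk 3.1.2 p.33] -/
theorem projC_self (N : OpenNormalSubgroup G) (h : N ≤ N) : projC hG h = 𝟙 (QC hG N) := by
  apply ObjectProperty.hom_ext
  change BTemp.proj hG h = 𝟙 (BTemp.Q hG N)
  exact BTemp.proj_self hG N h

/-- `projC` composes. [cite: MochizukiSemiAnbd2006, Rmk 3.1.2 p.33] -/
theorem projC_comp {N M L : OpenNormalSubgroup G} (h₁ : N ≤ M) (h₂ : M ≤ L) :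
    projC hG h₁ ≫ projC hG h₂ = projC hG (h₁.trans h₂) := by
  apply ObjectProperty.hom_ext
  change BTemp.proj hG h₁ ≫ BTemp.proj hG h₂ = BTemp.proj hG (h₁.trans h₂)
  exact BTemp.proj_comp hG h₁ h₂

/-- Right translations compose: `r_a ≫ r_b = r_{ab}`. [cite: MochizukiSemiAnbd2006, Rmk 3.1.2 p.33] -/
theorem rightMulC_comp (N : OpenNormalSubgroup G) (a b : G) :
    rightMulC hG N a ≫ rightMulC hG N b = rightMulC hG N (a * b) := by
  apply ObjectProperty.hom_ext
  change BTemp.rightMul hG N a ≫ BTemp.rightMul hG N b = BTemp.rightMul hG N (a * b)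
  exact BTemp.rightMul_comp hG N a b

/-- Right translation by `1` is the identity. [cite: MochizukiSemiAnbd2006, Rmk 3.1.2 p.33] -/
theorem rightMulC_one (N : OpenNormalSubgroup G) : rightMulC hG N 1 = 𝟙 (QC hG N) := by
  apply ObjectProperty.hom_ext
  change BTemp.rightMul hG N 1 = 𝟙 (BTemp.Q hG N)
  exact BTemp.rightMul_one hG N

/-- Right translations commute with the projections. [cite: MochizukiSemiAnbd2006, Rmk 3.1.2 p.33] -/
theorem rightMulC_projC {N M : OpenNormalSubgroup G} (h : N ≤ M) (g : G) :
    rightMulC hG N g ≫ projC hG h = projC hG h ≫ rightMulC hG M g := by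
  apply ObjectProperty.hom_ext
  change BTemp.rightMul hG N g ≫ BTemp.proj hG h = BTemp.proj hG h ≫ BTemp.rightMul hG M g
  exact BTemp.rightMul_proj hG h g

/-! ### The Galois pro-system along an antitone sequence of open normal subgroups -/

variable (N : ℕ → OpenNormalSubgroup G) (hN : Antitone N)

/-- **The Galois pro-system** `k ↦ Π/N_k` of the base `B^temp(Π)⁰`, a functor `ℕ ⥤ (B^temp(Π)⁰)ᵒᵖ` whose
transition maps are (the opposites of) the projections `Π/N_k → Π/N_j`, `j ≤ k` — "a universal covering
… by varying the objects `Aᵢ`" (FrdII p. 20). [cite: MochizukiFrdII2008, Thm 2.4 (ii) p.20] -/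
def galoisSystem : ℕ ⥤ (ConnectedPart (BTemp G))ᵒᵖ where
  obj k := op (QC hG (N k))
  map {j k} f := (projC hG (hN f.le)).op
  map_id k := by
    change (projC hG (hN le_rfl)).op = 𝟙 (op (QC hG (N k)))
    rw [projC_self, op_id]
  map_comp {i j k} f g := by
    change (projC hG (hN (f ≫ g).le)).op = (projC hG (hN f.le)).op ≫ (projC hG (hN g.le)).op
    rw [← op_comp, projC_comp]

/-- Terms of the Galois pro-system. [cite: MochizukiFrdII2008, Thm 2.4 (ii) p.21] -/
@[simp] theorem galoisSystem_obj (k : ℕ) : (galoisSystem hG N hN).obj k = op (QC hG (N k)) := rfl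

/-- Transition maps of the Galois pro-system: the projections. [cite: MochizukiFrdII2008, Thm 2.4 (ii) p.21] -/
theorem galoisSystem_map {j k : ℕ} (f : j ⟶ k) :
    (galoisSystem hG N hN).map f = (projC hG (hN f.le)).op := rfl

/-- Every term of the Galois pro-system is a GALOIS object of `B^temp(Π)` ([SemiAnbd] Def 3.1 (iv), Rmk 3.1.3).
[cite: MochizukiSemiAnbd2006, Rmk 3.1.3 p.34] -/
theorem isGaloisObj_galoisSystem (k : ℕ) : IsGaloisObj ((galoisSystem hG N hN).obj k).unop.obj :=
  GaloisObjects.isGaloisObj_of_iso_quotientObj hG _ (N k) (Iso.refl _)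

/-- **Cofinality** ("universal covering"): if the sequence `N` is cofinal among the neighbourhoods of `1`,
every object of the connected part `B^temp(Π)⁰` receives a morphism from some term `Π/N_k` of the system
(the orbit map of a point whose open stabiliser contains `N_k`). [cite: MochizukiSemiAnbd2006, Rmk 3.1.2 p.33] -/
theorem galoisSystem_cofinal (hNb : ∀ U ∈ 𝓝 (1 : G), ∃ k, (N k : Set G) ⊆ U)
    (X : ConnectedPart (BTemp G)) : ∃ k, Nonempty (((galoisSystem hG N hN).obj k).unop ⟶ X) := by
  obtain ⟨x⟩ := nonempty_of_isConnectedObj X.obj X.property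
  have hopen : IsOpen ((BTemp.stab X.obj x : Subgroup G) : Set G) := X.obj.property.2 x
  obtain ⟨k, hk⟩ := hNb _ (hopen.mem_nhds (BTemp.stab X.obj x).one_mem)
  exact ⟨k, ⟨ObjectProperty.homMk (BTemp.orbitMap hG X.obj x (N k) fun y hy => hk hy)⟩⟩

/-! ### `Π → Aut` of the pro-system: compatible families of right translations -/

/-- The automorphism of the pro-system given by `g ∈ Π`: right translation by `g` on every `Π/N_k`.
[cite: MochizukiFrdII2008, Thm 2.4 (ii) p.21] -/
def autOfElem (g : G) : Aut (galoisSystem hG N hN) :=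
  NatIso.ofComponents
    (fun k => (ObjectProperty.isoMk (C := BTemp G) (P := connectedObjects (BTemp G))
      { hom := BTemp.rightMul hG (N k) g
        inv := BTemp.rightMul hG (N k) g⁻¹
        hom_inv_id := by
          change BTemp.rightMul hG (N k) g ≫ BTemp.rightMul hG (N k) g⁻¹ = 𝟙 (BTemp.Q hG (N k))
          rw [BTemp.rightMul_comp, mul_inv_cancel, BTemp.rightMul_one]
        inv_hom_id := by
          change BTemp.rightMul hG (N k) g⁻¹ ≫ BTemp.rightMul hG (N k) g = 𝟙 (BTemp.Q hG (N k))
          rw [BTemp.rightMul_comp, inv_mul_cancel, BTemp.rightMul_one] }).op)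
    (fun {j k} f => by
      change (projC hG (hN f.le)).op ≫ (rightMulC hG (N k) g).op =
        (rightMulC hG (N j) g).op ≫ (projC hG (hN f.le)).op
      rw [← op_comp, ← op_comp, rightMulC_projC])

/-- Components of `autOfElem g`: right translation by `g`. [cite: MochizukiFrdII2008, Thm 2.4 (ii) p.21] -/
@[simp] theorem autOfElem_hom_app (g : G) (k : ℕ) :
    ((autOfElem hG N hN g).hom.app k) = (rightMulC hG (N k) g).op := rfl

/-- **`Π →* Aut` of the Galois pro-system.** [cite: MochizukiFrdII2008, Thm 2.4 (ii) p.21] -/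
def toAut : G →* Aut (galoisSystem hG N hN) where
  toFun := autOfElem hG N hN
  map_one' := by
    apply Iso.ext
    ext k
    change (rightMulC hG (N k) 1).op = 𝟙 (op (QC hG (N k)))
    rw [rightMulC_one, op_id]
  map_mul' a b := by
    apply Iso.ext
    ext k
    change (rightMulC hG (N k) (a * b)).op = (rightMulC hG (N k) b).op ≫ (rightMulC hG (N k) a).op
    rw [← op_comp, rightMulC_comp]

/-- `toAut g` is `autOfElem g`. [cite: MochizukiFrdII2008, Thm 2.4 (ii) p.21] -/
@[simp] theorem toAut_apply (g : G) : toAut hG N hN g = autOfElem hG N hN g := rfl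

/-- **Action formula**: the `k`-th component of `toAut g` acts on `Π/N_k` by `xN_k ↦ x g N_k`.
[cite: MochizukiFrdII2008, Thm 2.4 (ii) p.21] -/
theorem toAut_app_apply (g : G) (k : ℕ) (x : G) :
    ((toAut hG N hN g).hom.app k).unop.hom.hom.hom (x : G ⧸ (N k).toSubgroup) =
      ((x * g : G) : G ⧸ (N k).toSubgroup) :=
  BTemp.rightMul_apply hG (N k) g x

/-- `toAut` is injective when the sequence `N` is cofinal: an element translating trivially on every
`Π/N_k` lies in every open normal subgroup, hence is `1` ("separated"). [cite: MochizukiSemiAnbd2006, Def 3.1(i) p.33] -/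
theorem toAut_injective (hNb : ∀ U ∈ 𝓝 (1 : G), ∃ k, (N k : Set G) ⊆ U) :
    Function.Injective (toAut hG N hN) := by
  rw [← MonoidHom.ker_eq_bot_iff, Subgroup.eq_bot_iff_forall]
  intro g hg
  rw [MonoidHom.mem_ker] at hg
  -- `g ∈ N k` for every `k`
  have hmem : ∀ k, g ∈ N k := by
    intro k
    have h := congrArg (fun α : Aut (galoisSystem hG N hN) =>
      (α.hom.app k).unop.hom.hom.hom ((1 : G) : G ⧸ (N k).toSubgroup)) hg
    simp only at h
    rw [toAut_app_apply, one_mul] at h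
    have h' : (g : G ⧸ (N k).toSubgroup) = ((1 : G) : G ⧸ (N k).toSubgroup) := h
    rw [QuotientGroup.eq, mul_one, inv_mem_iff] at h'
    exact h'
  by_contra hne
  obtain ⟨M, hM⟩ := hG.separated g hne
  obtain ⟨k, hk⟩ := hNb _ M.toOpenSubgroup.mem_nhds_one
  exact hM (hk (hmem k))

omit [TopologicalSpace G] [IsTopologicalGroup G] in
/-- Casting a coset equality to a larger subgroup (private plumbing). [folklore] -/
private theorem coe_eq_coe_of_le {K K' : Subgroup G} (hKK' : K ≤ K') {a b : G}
    (h : (a : G ⧸ K) = (b : G ⧸ K)) : (a : G ⧸ K') = (b : G ⧸ K') := by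
  rw [QuotientGroup.eq] at h ⊢
  exact hKK' h

/-- `toAut` is surjective: a compatible family of automorphisms of the `Π/N_k` is a compatible family of
cosets `g_k N_k`, which comes from one `g ∈ Π` ("complete"). [cite: MochizukiSemiAnbd2006, Def 3.1(i) p.33] -/
theorem toAut_surjective (hNb : ∀ U ∈ 𝓝 (1 : G), ∃ k, (N k : Set G) ⊆ U) :
    Function.Surjective (toAut hG N hN) := by
  classical
  intro α
  -- the value `g_k N_k` of the `k`-th component (a `B^temp`-endomorphism of `Π/N_k`) at the base point
  have hgk : ∀ k, ∃ g : G, (α.hom.app k).unop.hom.hom.hom ((1 : G) : G ⧸ (N k).toSubgroup) =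
      (g : G ⧸ (N k).toSubgroup) := fun k => by
    obtain ⟨g, hg⟩ :=
      QuotientGroup.mk_surjective ((α.hom.app k).unop.hom.hom.hom ((1 : G) : G ⧸ (N k).toSubgroup))
    exact ⟨g, hg.symm⟩
  choose g hg using hgk
  -- equivariance: the component acts as right translation by `g_k`
  have hact : ∀ (k : ℕ) (x : G), (α.hom.app k).unop.hom.hom.hom (x : G ⧸ (N k).toSubgroup) =
      ((x * g k : G) : G ⧸ (N k).toSubgroup) := by
    intro k x
    have h := hom_ρ (α.hom.app k).unop.hom x ((1 : G) : G ⧸ (N k).toSubgroup)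
    change (α.hom.app k).unop.hom.hom.hom ((BTemp.Q hG (N k)).obj.ρ x ((1 : G) : G ⧸ (N k).toSubgroup)) =
      (BTemp.Q hG (N k)).obj.ρ x ((α.hom.app k).unop.hom.hom.hom ((1 : G) : G ⧸ (N k).toSubgroup)) at h
    rw [BTemp.Q_ρ_apply, mul_one] at h
    rw [h, hg k, BTemp.Q_ρ_apply]
  -- compatibility along the projections (naturality of `α`, unop'd and evaluated at the base point)
  have hcompat : ∀ j k, j ≤ k → (g k : G ⧸ (N j).toSubgroup) = (g j : G ⧸ (N j).toSubgroup) := by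
    intro j k hjk
    have h2 : (α.hom.app k).unop.hom ≫ BTemp.proj hG (hN hjk) =
        BTemp.proj hG (hN hjk) ≫ (α.hom.app j).unop.hom :=
      congrArg (fun f => f.unop.hom) (α.hom.naturality (homOfLE hjk : j ⟶ k))
    have h4 := congrArg (fun f => f.hom.hom ((1 : G) : G ⧸ (N k).toSubgroup)) h2
    simp only at h4
    change (BTemp.proj hG (hN hjk)).hom.hom ((α.hom.app k).unop.hom.hom.hom ((1 : G) : G ⧸ (N k).toSubgroup)) =
      (α.hom.app j).unop.hom.hom.hom ((BTemp.proj hG (hN hjk)).hom.hom ((1 : G) : G ⧸ (N k).toSubgroup))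
      at h4
    rw [hg k, BTemp.proj_apply, BTemp.proj_apply, hg j] at h4
    exact h4
  -- … hence for any two indices whose subgroups are nested
  have hcompat' : ∀ i j, N j ≤ N i → (g j : G ⧸ (N i).toSubgroup) = (g i : G ⧸ (N i).toSubgroup) := by
    intro i j hji
    rcases le_total i j with hij | hij
    · exact hcompat i j hij
    · have h := hcompat j i hij
      rw [QuotientGroup.eq] at h ⊢
      have h' : (g i)⁻¹ * g j ∈ (N i).toSubgroup := hji h
      simpa using (N i).toSubgroup.inv_mem h'
  -- the family over ALL open normal subgroups
  have hkOf : ∀ M : OpenNormalSubgroup G, ∃ k, N k ≤ M := fun M => by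
    obtain ⟨k, hk⟩ := hNb (M : Set G) M.toOpenSubgroup.mem_nhds_one
    exact ⟨k, SetLike.coe_subset_coe.mp hk⟩
  choose kOf hkOf using hkOf
  obtain ⟨y, hy⟩ := hG.complete (fun M => (g (kOf M) : G ⧸ M.toSubgroup)) (by
    intro M M' hMM' y hy
    have h1 : (g (max (kOf M) (kOf M')) : G ⧸ M'.toSubgroup) = (g (kOf M') : G ⧸ M'.toSubgroup) :=
      coe_eq_coe_of_le (hkOf M') (hcompat' (kOf M') _ (hN (le_max_right _ _)))
    have h2 : (g (max (kOf M) (kOf M')) : G ⧸ M'.toSubgroup) = (g (kOf M) : G ⧸ M'.toSubgroup) :=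
      coe_eq_coe_of_le ((hkOf M).trans hMM') (hcompat' (kOf M) _ (hN (le_max_left _ _)))
    rw [← h1, h2]
    exact coe_eq_coe_of_le hMM' hy)
  -- `g_k N_k = y N_k` for every `k`
  have hyk : ∀ k, (g k : G ⧸ (N k).toSubgroup) = (y : G ⧸ (N k).toSubgroup) := fun k => by
    rw [← hy (N k)]
    exact (hcompat' k (kOf (N k)) (hkOf (N k))).symm
  refine ⟨y, ?_⟩
  apply Iso.ext
  ext k : 2
  apply Quiver.Hom.unop_inj
  apply ObjectProperty.hom_ext
  change BTemp.rightMul hG (N k) y = (α.hom.app k).unop.hom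
  apply hom_ext_apply
  intro q
  obtain ⟨z, rfl⟩ := QuotientGroup.mk_surjective q
  have key : ((z * g k : G) : G ⧸ (N k).toSubgroup) = ((z * y : G) : G ⧸ (N k).toSubgroup) := by
    rw [QuotientGroup.mk_mul, QuotientGroup.mk_mul, hyk k]
  rw [BTemp.rightMul_apply]
  exact key.symm.trans (hact k z).symm

/-- **`Π ≃* Aut` of the Galois pro-system** (cofinal case): the fundamental group of the base IS the group of
compatible families of automorphisms of a universal covering. [cite: MochizukiSemiAnbd2006, Rmk 3.2.1 p.35] -/
def toAutMulEquiv (hNb : ∀ U ∈ 𝓝 (1 : G), ∃ k, (N k : Set G) ⊆ U) : G ≃* Aut (galoisSystem hG N hN) :=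
  MulEquiv.ofBijective (toAut hG N hN) ⟨toAut_injective hG N hN hNb, toAut_surjective hG N hN hNb⟩

/-- `toAutMulEquiv` is `toAut` on elements. [cite: MochizukiFrdII2008, Thm 2.4 (ii) p.21] -/
@[simp] theorem toAutMulEquiv_apply (hNb : ∀ U ∈ 𝓝 (1 : G), ∃ k, (N k : Set G) ⊆ U) (g : G) :
    toAutMulEquiv hG N hN hNb g = toAut hG N hN g := rfl

/-! ### The packaged statement of G-w5d188-1 (a) -/

include hG in
/-- For `Π` tempered and Galois-countable there is a cofinal antitone SEQUENCE of open normal subgroups.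
[cite: MochizukiSemiAnbd2006, Rmk 3.1.2 p.33] -/
theorem exists_antitone_cofinal_seq [SecondCountableTopology G] :
    ∃ N : ℕ → OpenNormalSubgroup G, Antitone N ∧ ∀ U ∈ 𝓝 (1 : G), ∃ k, (N k : Set G) ⊆ U := by
  obtain ⟨N, -, hNb⟩ := hG.hasBasis_nhds_one.exists_antitone_subbasis
  exact ⟨N, fun j k hjk => SetLike.coe_subset_coe.mp (hNb.antitone hjk), fun U hU => hNb.mem_iff.mp hU⟩

include hG in
/-- **G-w5d188-1 (a): the universal-covering pro-system of the base and `Aut = Π`.**  For `Π` tempered and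
Galois-countable there is a pro-system `c : ℕ ⥤ (B^temp(Π)⁰)ᵒᵖ` of GALOIS objects, COFINAL in the sense that
every object of `B^temp(Π)⁰` receives a morphism from some term, whose group of automorphisms (compatible
families of deck transformations) is isomorphic to `Π`.  The system is `galoisSystem` along any cofinal
antitone sequence of open normal subgroups and the isomorphism is `toAutMulEquiv` (action formula
`toAut_app_apply`). [cite: MochizukiFrdII2008, Thm 2.4 (ii) p.20] -/
theorem exists_galois_cofinal_system_aut_equiv [SecondCountableTopology G] :
    ∃ c : ℕ ⥤ (ConnectedPart (BTemp G))ᵒᵖ,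
      (∀ k, IsGaloisObj (c.obj k).unop.obj) ∧
      (∀ X : ConnectedPart (BTemp G), ∃ k, Nonempty ((c.obj k).unop ⟶ X)) ∧
      Nonempty (G ≃* Aut c) := by
  obtain ⟨N, hN, hNb⟩ := exists_antitone_cofinal_seq hG
  exact ⟨galoisSystem hG N hN, isGaloisObj_galoisSystem hG N hN, galoisSystem_cofinal hG N hN hNb,
    ⟨toAutMulEquiv hG N hN hNb⟩⟩

end BaseGaloisSystem

end Literature.AlgebraicGeometry.Frobenioids

end
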